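import Mathlib
import HarnessLib
import Summits.CriticalPhenomena.CardyFormulaZ2.Theses.CardyRotToConf
import Summits.CriticalPhenomena.CardyFormulaZ2.Theses.CardySelfRefinement
import Literature.Probability.RandomPlanarGeometry.ConformalRestrictionCovariance
import Literature.Probability.RandomPlanarGeometry.SLEUniquenessInLaw
import Literature.Probability.RandomPlanarGeometry.LatticeSimilarityCovariance

/-!
# Line `isotropy-kills-beltrami` — crux stmt-CriticalPhenomena-0698 (`CardyRotToConfR2SymmetryUpgrade`)

Crux (fixed, by name): `Summit.CriticalPhenomena.CardyFormulaZ2.Theses.CardyRotToConf.CardyRotToConfR2SymmetryUpgrade`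
= `∀ P, IsLocalMarkovChordalFamily P → NonTracing P → ∀ D, IsSLELaw 6 D (P D)` (shared verbatim with
`CardySelfRefinement.SymmetryUpgrade`).

LINE (planner crux-plan, 2026-08-15; card `Lines/isotropy-kills-beltrami.md`). "Isotropy kills Beltrami":
an admissible family is first UNIFORMISED topologically — it is conformally covariant for SOME conformal
structure `Φ^*(std)` on the plane (S1, the bet, fed by the regularity S0 that any proof must extract from the
axioms) — then transported (S2) and identified as the SLE₆ family in that structure by Schramm–LSW (S3); finally
similarity covariance of the ORIGINAL family forces the uniformiser `Φ` to conjugate the similarity group into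
the conformal-affine group, which makes `Φ` affine with complex-(anti)linear part: its Beltrami coefficient is a
rotation-invariant constant, i.e. zero (S4). Composition `CardyRotToConfR2SymmetryUpgrade_of` is sorry-free; the
`stub_*` theorems are the registered stubs (seven after the lead's reshape of S4 into S4a/S4b/S4c, 2026-08-16);
`composition` is the sorry-free implication "stub statements ⇒ crux statement" (S0–S3 verbatim, S4 via the sorry-free
glue `isotropyRigidity_of_stubs`), and `CardyRotToConfR2SymmetryUpgrade_of` concludes the crux BY NAME from the stubs.

Disproof.lean obligations honoured: IsChordal's target clause and non-tracing are used in S3 (and S0(b));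
no stub is an instance of a landed Negative lemma (none has landed for this crux); the junk inhabitants on record
(J1/J2'', bisector explorers) bear on S0 only.
-/

noncomputable section

namespace Summit.CriticalPhenomena.CardyFormulaZ2.Cruxes.CardyRotToConfR2SymmetryUpgrade.IsotropyKillsBeltrami

open MeasureTheory Set Filter Topology
open Literature.Probability.RandomPlanarGeometry
open scoped ENNReal unitInterval

/-- Registered stub `stub_regularityFromAxioms` (RegularityFromAxioms). S0 · REGULARITY FROM THE AXIOMS (the junk canary; open, false iff germ-rule junk inhabits the typed bundle).
Every admissible (local Markov similarity-covariant) non-tracing chordal family has (a) NON-DEGENERATE CROSSINGS —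
in every conformal rectangle `(Ω; x₀,x₁,x₂,x₃)` the curve from `x₀` to `x₂` hits `(x₂x₃)` before `(x₁x₂)` with
probability strictly between `0` and `1` (the convention of `sle_six_measureReal_hitsBefore`; for SLE₆ this is
Cardy's value `F(η) ∈ (0,1)`), and (b) INSTANT TWO-SIDED BOUNDARY RETURN at the starting point — a.s. the trace
meets BOTH boundary arcs at points other than `a = D.pt 0` arbitrarily close to `a` (ideator 1's (E4), range form).
Both are topological, hence NECESSARY for the line (they are invariant under conjugation by a plane homeomorphism
and hold for SLE₆, so S1 ∧ S3 force them). This is the stub where the typed/informal gap of the crux lives: the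
deterministic/germ-rule inhabitants on record (J1/J2'' of Evidence-JunkInhabitants, the polygonal bisector
explorers of EXPLORER.md) violate (b) (they leave `a` along a straight segment) and (a) (Dirac crossing values);
if one of them is confirmed to satisfy the typed bundle (modulo the SLE₆ facts F1–F4 / a termination theorem) this
stub and the crux die together (class refuted-misstated), and on the repaired crux R2⁺ (+InstantReturn
+DomainContinuous) resp. R2Reversible clause (b) becomes a hypothesis and only (a) remains to be derived. -/
theorem stub_regularityFromAxioms :
    ∀ P : ChordalFamily, IsLocalMarkovChordalFamily P →
      (∀ D : DobrushinDomain, ∀ᵐ γ ∂(P D), ∀ c : Curve ℂ, CurveClass.mk c = γ →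
        ∀ s t : unitInterval, s < t → c '' Set.Icc s t ⊆ frontier D.carrier →
          (c '' Set.Icc s t).Subsingleton) →
      (∀ R : ConformalRectangle, 0 < P (R.chord 0 2 (by decide)) (CurveClass.hitsBefore (R.arc 2) (R.arc 1)) ∧
        P (R.chord 0 2 (by decide)) (CurveClass.hitsBefore (R.arc 2) (R.arc 1)) < 1) ∧
      (∀ D : DobrushinDomain, ∀ᵐ γ ∂(P D), ∀ ε : ℝ, 0 < ε → ∀ i : Fin 2,
        ∃ z ∈ γ.range ∩ D.arc i, z ≠ D.pt 0 ∧ dist z (D.pt 0) < ε) := by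
  sorry

/-- Registered stub `stub_quasiUniformisation` (QuasiUniformisation). S1 · QUASI-UNIFORMISATION = the idea's `QuasiInvariance`, typed (the bet; XL). An admissible non-tracing
family with the regularity of S0 is conformally covariant for SOME topological conformal structure on the plane:
there is a homeomorphism `Φ : ℂ ≃ₜ ℂ` such that the transported family `D ↦ Φ_* P(Φ⁻¹ D)` is conformally covariant
in the tree's sense (`ChordalFamily.IsConformallyCovariant`, Werner 2007 §3.2 (1)). When `Φ` is quasiconformal the
structure is the measurable Beltrami coefficient `μ_Φ = ∂̄Φ/∂Φ` ("P is SLE₆ in the μ-metric"); the topological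
phrasing needs no quasiconformal theory. WHY EASIER than the crux: the conclusion does not mention SLE, Cardy or the
standard conformal structure — it asks for a structure READ OFF P, and reconstruction theorems for conformal
structures from modulus-type data exist that presuppose no conformal invariance: define the P-modulus of a Jordan
quadrilateral `m_P(Q) := F⁻¹(P-crossing probability)`; locality gives monotonicity in the domain (LSW Cor. 2.4,
`CrossingMonotone`), similarity covariance + S0(a) give RSW-type comparability at all scales, and Cannon's
combinatorial Riemann mapping theorem (Acta Math. 173 (1994)) / Cannon–Floyd–Parry (finite Riemann mapping,
1994) / Schramm's square tilings (1993) / Bonk–Kleiner quasisymmetric uniformisation (Invent. 2002) turn an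
axiomatic modulus with such comparability (+ an asymptotic-conformality condition, the real content) into a
quasisymmetric, then conformal, structure. Rotation covariance is NOT used here (stretched SLE₆ `A_* SLE₆(A⁻¹·)`
satisfies S1 with `Φ = A` linear) — isotropy enters only in S4. Candidate internal cut for the lead (NOT stubs):
(i) Cannon-type axioms for `m_P` from locality/Markov/S0; (ii) asymptotic conformality of `m_P` at small scales
(the open heart: a universality statement for the P-modulus of microscopic quadrilaterals); (iii) from the resulting
`Φ`, conformal INVARIANCE of all crossing data of `Φ_* P Φ⁻¹`, then covariance of the laws via the F3 determination
lemma (crossing data on 4-marked sub-configurations determine an admissible family: LSW hull trick + Choquet,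
typed over `ConformalRectangle` as triage F2 prescribes). -/
theorem stub_quasiUniformisation :
    ∀ P : ChordalFamily, IsLocalMarkovChordalFamily P →
      (∀ D : DobrushinDomain, ∀ᵐ γ ∂(P D), ∀ c : Curve ℂ, CurveClass.mk c = γ →
        ∀ s t : unitInterval, s < t → c '' Set.Icc s t ⊆ frontier D.carrier →
          (c '' Set.Icc s t).Subsingleton) →
      (∀ R : ConformalRectangle, 0 < P (R.chord 0 2 (by decide)) (CurveClass.hitsBefore (R.arc 2) (R.arc 1)) ∧
        P (R.chord 0 2 (by decide)) (CurveClass.hitsBefore (R.arc 2) (R.arc 1)) < 1) →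
      (∀ D : DobrushinDomain, ∀ᵐ γ ∂(P D), ∀ ε : ℝ, 0 < ε → ∀ i : Fin 2,
        ∃ z ∈ γ.range ∩ D.arc i, z ≠ D.pt 0 ∧ dist z (D.pt 0) < ε) →
      ∃ Φ : ℂ ≃ₜ ℂ, ChordalFamily.IsConformallyCovariant
        (fun D : DobrushinDomain => (P (D.map Φ.symm)).map (CurveClass.map (Φ : C(ℂ, ℂ)))) := by
  sorry

/-- Registered stub `stub_conjTransport` (ConjTransport). S2 · TRANSPORT OF STRUCTURE (M; true modulo the named facts `CurveClass.stopAt_mk` / `startFrom_mk`).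
Conjugating a chordal family by ANY plane homeomorphism `Φ` (`D ↦ Φ_* P(Φ⁻¹D)`, `Φ⁻¹D = D.map Φ.symm`) preserves the
four topological axioms of the bundle — chordality, the typed domain Markov property (kernel
`Q' D p := Φ_* Q (Φ⁻¹D) (Φ⁻¹_* p)`; `remainingDomain`, `stopAt`, `startFrom`, tip and target commute with `Φ`),
locality in restriction form and target independence (arcs of `D.map Φ` are images of arcs, `MarkedDomain.arc_map`)
— and the non-tracing clause (every representative of `Φ_* γ` is `Φ ∘ c` for a representative `c` of `γ`;
`frontier (Φ⁻¹D) = Φ⁻¹(frontier D)`; `CurveClass.map Φ` is a Borel bijection so null sets transport). Similarity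
covariance is NOT transported (it is supplied for the conjugate family by its conformal covariance,
`IsConformallyCovariant.isSimilarityCovariant`, inside `_of`). Triage r1-3 §3 checked this naturality informally
("ConjNatural holds for the TYPED IsMarkovExtension"). -/
theorem stub_conjTransport :
    ∀ (P : ChordalFamily) (Φ : ℂ ≃ₜ ℂ), P.IsChordal → P.IsDomainMarkov → P.IsLocal →
      P.IsTargetIndependent →
      (∀ D : DobrushinDomain, ∀ᵐ γ ∂(P D), ∀ c : Curve ℂ, CurveClass.mk c = γ →
        ∀ s t : unitInterval, s < t → c '' Set.Icc s t ⊆ frontier D.carrier →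
          (c '' Set.Icc s t).Subsingleton) →
      ChordalFamily.IsChordal (fun D : DobrushinDomain => (P (D.map Φ.symm)).map (CurveClass.map (Φ : C(ℂ, ℂ)))) ∧
      ChordalFamily.IsDomainMarkov (fun D : DobrushinDomain => (P (D.map Φ.symm)).map (CurveClass.map (Φ : C(ℂ, ℂ)))) ∧
      ChordalFamily.IsLocal (fun D : DobrushinDomain => (P (D.map Φ.symm)).map (CurveClass.map (Φ : C(ℂ, ℂ)))) ∧
      ChordalFamily.IsTargetIndependent (fun D : DobrushinDomain => (P (D.map Φ.symm)).map (CurveClass.map (Φ : C(ℂ, ℂ)))) ∧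
      (∀ D : DobrushinDomain, ∀ᵐ γ ∂((P (D.map Φ.symm)).map (CurveClass.map (Φ : C(ℂ, ℂ)))), ∀ c : Curve ℂ, CurveClass.mk c = γ →
        ∀ s t : unitInterval, s < t → c '' Set.Icc s t ⊆ frontier D.carrier →
          (c '' Set.Icc s t).Subsingleton) := by
  sorry

/-- Registered stub `stub_typedSchrammLSW` (TypedSchrammLSW). S3 · SCHRAMM'S PRINCIPLE + LSW LOCALITY FOR THE TYPED BUNDLE (the shared back end F3 of triage r1-1, in its
covariance form = bending-information-gap's K4; L–XL, known template). A conformally covariant, local, domain-Markov,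
target-independent, non-tracing chordal family is the chordal SLE₆ law in every Dobrushin domain: conformal covariance +
Markov ⇒ the driving process of the Loewner chain in `ℍ` has stationary independent increments and Brownian scaling ⇒
`√κ B` (Schramm 2000 §1, Werner 2007 §3.2–3.8); locality ⇒ Cardy's crossing values in all rectangles ⇒ `κ = 6`
(LSW 2001 §3 = tree fact `eq_six_of_forall_measureReal_hitsBefore`); identification of the law with `IsSLELaw 6 D`
via `exists_isSLECurve` / `IsSLECurve.map_eq`. Typed caveat (REVIEW.md §2.5, TightnessNotes "KernelIdentification"):
the tree's `IsDomainMarkov` only constrains the kernel through `(remaining set, tip, b)` and couples it to `P` on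
JORDAN remaining sets, so Schramm's argument must be re-run through boundary renewals / hull-hitting data
(LSW hull trick) rather than slit-domain laws — this is real work, not bookkeeping. Uses IsChordal's target clause and
non-tracing (Disproof.lean `crux_false_without_isChordal` / `_targetClause`: `tipFamily` and boundary tracers are
conformally covariant). -/
theorem stub_typedSchrammLSW :
    ∀ Q : ChordalFamily, IsLocalMarkovChordalFamily Q →
      (∀ D : DobrushinDomain, ∀ᵐ γ ∂(Q D), ∀ c : Curve ℂ, CurveClass.mk c = γ →
        ∀ s t : unitInterval, s < t → c '' Set.Icc s t ⊆ frontier D.carrier →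
          (c '' Set.Icc s t).Subsingleton) →
      Q.IsConformallyCovariant →
      ∀ D : DobrushinDomain, IsSLELaw 6 D (Q D) := by
  sorry

/-! ### S4 "isotropy kills Beltrami", reshaped by the lead (2026-08-16) into three registered stubs
`stub_slePreservingIsMoebius` (S4a, the analytic heart: an SLE₆-family-preserving plane homeomorphism is an
(anti)similarity), `stub_similarityConjugateRigidity` (S4b, the group lemma) and `stub_sleSixIsometryInvariance`
(S4c, invariance of the SLE₆ laws under similarities and complex conjugation), glued by the sorry-free
`isotropyRigidity_of_stubs`, whose statement is VERBATIM the former single stub `stub_isotropyRigidity`. -/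

/-- Registered stub `stub_slePreservingIsMoebius` (S4a · FAMILY-PRESERVING HOMEOMORPHISMS ARE MÖBIUS; L–XL, classical).
A homeomorphism `T` of the plane which pushes the chordal SLE₆ law of every Dobrushin domain `D` to the chordal SLE₆ law
of the image domain `T D` is an orientation-preserving similarity `z ↦ cz + w` or an orientation-reversing one
`z ↦ c z̄ + w`. Proof plan (lead): (R1) `T` preserves Cardy's crossing value of every conformal rectangle
(`sle_six_measureReal_hitsBefore_holds`; `hitsBefore` commutes with `CurveClass.map T` for injective `T`), hence, by
`strictMonoOn_cardyFunction_holds` and `crossRatio_eq_of_isUniformizing_holds`, the cross-ratio / conformal modulus of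
EVERY conformal rectangle; (R2) for every Jordan domain `Ω` the boundary map `T|∂Ω` therefore agrees with the boundary
values of a conformal-or-anticonformal map `g_Ω : Ω → TΩ` (three points normalise the Riemann map, the cross-ratio with
the fourth point is injective in the fourth point); (R2') interior agreement `T|Ω = g_Ω`: for `z₀ ∈ Ω = ` a disc `B`, cut
`B` by the diameter through `z₀` into a half-disc `H` (Jordan); `k := g_B⁻¹ ∘ g_H : H → B` is (anti)conformal with
boundary values `id` on the half-circle; the conformal case gives `k = id` (a holomorphic map on `H` continuous up to an
arc where it is the identity is the identity: product-over-rotations trick after uniformising, or Schwarz reflection),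
the anticonformal case is impossible (compose with the reflection in the circle: the same uniqueness forces `k` to be
that reflection, which does not map `H` into `B`); so `T z₀ = g_H z₀ = g_B z₀`; (R2'') hence `T` is conformal or
anticonformal on every disc, so on `ℂ`, and a conformal automorphism of `ℂ` is affine (`T` is proper, so `∞` is a pole,
so `T` is a polynomial, injective hence of degree one). Uses only `κ = 6` through Cardy's formula. -/
theorem stub_slePreservingIsMoebius :
    ∀ T : ℂ ≃ₜ ℂ,
      (∀ (D : DobrushinDomain) (μ : Measure (CurveClass ℂ)), IsSLELaw 6 D μ →
        IsSLELaw 6 (D.map T) (μ.map (CurveClass.map (T : C(ℂ, ℂ))))) →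
      ∃ (c : ℂ) (hc : c ≠ 0) (w : ℂ), T = similarity c hc w ∨
        T = Complex.conjLIE.toHomeomorph.trans (similarity c hc w) := by
  sorry

/-- Registered stub `stub_similarityConjugateRigidity` (S4b · THE GROUP LEMMA; M, elementary).
A plane homeomorphism `Φ` which conjugates every orientation-preserving similarity `S : z ↦ cz + w` into an
(anti)similarity (`Φ ∘ S ∘ Φ⁻¹ = z ↦ c'z + w'` or `z ↦ c' z̄ + w'`) is itself an (anti)similarity. Proof plan (lead):
`T_w := Φ τ_w Φ⁻¹` is the square of `T_{w/2}`, hence an orientation-PRESERVING similarity `z ↦ a z + b`, and it is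
fixed-point free for `w ≠ 0` (conjugate of a translation), so `a = 1`: `T_w = τ_{L w}` with `L` additive and continuous,
hence real-linear (`AddMonoidHom.toRealLinearMap`), and `Φ (z + w) = Φ z + L w` gives `Φ = L + Φ 0`; then
`M_c := L ∘ (c ·) ∘ L⁻¹` is the linear part of `Φ S_c Φ⁻¹`, so complex-linear or antilinear; `M_i ^ 2 = -1` excludes the
antilinear case for `c = i` (`(z ↦ a z̄)² = |a|² z`), so `M_i = ± i ·`, and every `M_c` commutes with `M_i` (the `M_c`
commute among themselves), so `L J L⁻¹ = ± J`, i.e. `L` is complex-linear (`L z = λ z`) or antilinear (`L z = λ z̄`).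
Convention: `Φ.symm.trans (S.trans Φ)` is `Φ ∘ S ∘ Φ⁻¹` (`Homeomorph.trans f g = g ∘ f`), and
`Complex.conjLIE.toHomeomorph.trans (similarity c hc w)` is `z ↦ c z̄ + w`
(`conjLIE_toHomeomorph_trans_similarity_apply`). -/
theorem stub_similarityConjugateRigidity :
    ∀ Φ : ℂ ≃ₜ ℂ,
      (∀ (c : ℂ) (hc : c ≠ 0) (w : ℂ), ∃ (c' : ℂ) (hc' : c' ≠ 0) (w' : ℂ),
        Φ.symm.trans ((similarity c hc w).trans Φ) = similarity c' hc' w' ∨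
        Φ.symm.trans ((similarity c hc w).trans Φ) =
          Complex.conjLIE.toHomeomorph.trans (similarity c' hc' w')) →
      ∃ (c : ℂ) (hc : c ≠ 0) (w : ℂ), Φ = similarity c hc w ∨
        Φ = Complex.conjLIE.toHomeomorph.trans (similarity c hc w) := by
  sorry

/-- Registered stub `stub_sleSixIsometryInvariance` (S4c · SLE₆ LAWS UNDER (ANTI)SIMILARITIES; M for the similarity
half, L for the reflection half). The push-forward of the chordal SLE₆ law of `D` along an (anti)similarity `φ` is the
chordal SLE₆ law of `φ D`. Similarity half: a family of SLE₆ laws is conformally covariant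
(`ChordalFamily.isConformallyCovariant_of_isSLELaw`, hence `IsConformallyCovariant.isSimilarityCovariant`) and SLE₆
laws exist and are unique (`exists_isSLELaw_of_ne_eight`, `IsSLELaw.unique'`). Reflection half (the symmetry `B ↦ −B`
of the driving function: `identDistrib_sleDriving_neg`; the `ℍ`-hulls/trace of `−W` are the images of those of `W`
under `σ : x + iy ↦ −x + iy`; `conj ∘ φ ∘ σ` is a chordal uniformizing map of `conj D`): Rohde–Schramm 2005 §2 /
Lawler 2005 §6. By `covariant_trans`-type bookkeeping it suffices to treat similarities and `conj` separately. -/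
theorem stub_sleSixIsometryInvariance :
    ∀ φ : ℂ ≃ₜ ℂ,
      (∃ (c : ℂ) (hc : c ≠ 0) (w : ℂ), φ = similarity c hc w ∨
        φ = Complex.conjLIE.toHomeomorph.trans (similarity c hc w)) →
      ∀ (D : DobrushinDomain) (μ : Measure (CurveClass ℂ)), IsSLELaw 6 D μ →
        IsSLELaw 6 (D.map φ) (μ.map (CurveClass.map (φ : C(ℂ, ℂ)))) := by
  sorry

/-! #### Glue for S4 (sorry-free) -/

section GlueS4

/-- `Φ ∘ (Φ⁻¹ ∘ S ∘ Φ)`-type simplification: `Φ.trans (Φ.symm.trans X) = X`. -/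
theorem trans_symm_trans_cancel (Φ X : ℂ ≃ₜ ℂ) : Φ.trans (Φ.symm.trans X) = X :=
  Homeomorph.ext fun z => by simp

/-- `(Φ⁻¹ ∘ S ∘ Φ)`-type simplification on the other side: `(Φ.symm.trans (S.trans Φ)).trans Φ.symm = Φ.symm.trans S`. -/
theorem symm_trans_trans_trans_symm (Φ S : ℂ ≃ₜ ℂ) :
    (Φ.symm.trans (S.trans Φ)).trans Φ.symm = Φ.symm.trans S :=
  Homeomorph.ext fun z => by simp

/-- `MarkedDomain.map` along the identity homeomorphism. -/
theorem markedDomain_map_refl {n : ℕ} (D : MarkedDomain n) : D.map (Homeomorph.refl ℂ) = D :=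
  MarkedDomain.ext (JordanDomain.ext (by simp) rfl) rfl

/-- `D ↦ (D.map Φ).map Φ.symm` is the identity. -/
theorem markedDomain_map_map_symm {n : ℕ} (D : MarkedDomain n) (Φ : ℂ ≃ₜ ℂ) :
    (D.map Φ).map Φ.symm = D := by
  rw [MarkedDomain.map_map, Homeomorph.self_trans_symm, markedDomain_map_refl]

/-- `CurveClass.map` along the identity homeomorphism is the identity. -/
theorem curveClassMap_refl : CurveClass.map ((Homeomorph.refl ℂ : ℂ ≃ₜ ℂ) : C(ℂ, ℂ)) = id := by
  funext c
  obtain ⟨γ, rfl⟩ := CurveClass.surjective_mk c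
  rw [CurveClass.map_mk, id]
  congr 1

/-- Push-forward along `Φ` then `Φ⁻¹` is the identity on laws. -/
theorem measure_map_map_symm (μ : Measure (CurveClass ℂ)) (Φ : ℂ ≃ₜ ℂ) :
    (μ.map (CurveClass.map (Φ : C(ℂ, ℂ)))).map (CurveClass.map (Φ.symm : C(ℂ, ℂ))) = μ := by
  rw [Measure.map_map (CurveClass.measurable_map _) (CurveClass.measurable_map _),
    ← CurveClass.map_homeomorph_trans, Homeomorph.self_trans_symm, curveClassMap_refl, Measure.map_id]

/-- The inverse of an (anti)similarity is an (anti)similarity. -/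
theorem symm_isAntiSimilarity {Φ : ℂ ≃ₜ ℂ}
    (h : ∃ (c : ℂ) (hc : c ≠ 0) (w : ℂ), Φ = similarity c hc w ∨
      Φ = Complex.conjLIE.toHomeomorph.trans (similarity c hc w)) :
    ∃ (c : ℂ) (hc : c ≠ 0) (w : ℂ), Φ.symm = similarity c hc w ∨
      Φ.symm = Complex.conjLIE.toHomeomorph.trans (similarity c hc w) := by
  obtain ⟨c, hc, w, h | h⟩ := h
  · refine ⟨c⁻¹, inv_ne_zero hc, -(c⁻¹ * w), Or.inl (Homeomorph.ext fun z => ?_)⟩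
    rw [h, Homeomorph.symm_apply_eq, similarity_apply, similarity_apply]
    field_simp
    ring
  · refine ⟨(starRingEnd ℂ) c⁻¹, by simpa using hc, (starRingEnd ℂ) (-(c⁻¹ * w)),
      Or.inr (Homeomorph.ext fun z => ?_)⟩
    rw [h, Homeomorph.symm_apply_eq]
    simp only [conjLIE_toHomeomorph_trans_similarity_apply, map_add, map_mul, map_neg, map_inv₀,
      Complex.conj_conj]
    field_simp
    ring

/-- **S4 from S4a + S4b + S4c** (sorry-free; tree theorems used: uniqueness of the SLE₆ law `IsSLELaw.unique'`,
functoriality `MarkedDomain.map_map` / `CurveClass.map_homeomorph_trans`, measurability `CurveClass.measurable_map`).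
The statement is verbatim the former registered stub `stub_isotropyRigidity`. -/
theorem isotropyRigidity_of_stubs
    (h4a : ∀ T : ℂ ≃ₜ ℂ,
      (∀ (D : DobrushinDomain) (μ : Measure (CurveClass ℂ)), IsSLELaw 6 D μ →
        IsSLELaw 6 (D.map T) (μ.map (CurveClass.map (T : C(ℂ, ℂ))))) →
      ∃ (c : ℂ) (hc : c ≠ 0) (w : ℂ), T = similarity c hc w ∨
        T = Complex.conjLIE.toHomeomorph.trans (similarity c hc w))
    (h4b : ∀ Φ : ℂ ≃ₜ ℂ,
      (∀ (c : ℂ) (hc : c ≠ 0) (w : ℂ), ∃ (c' : ℂ) (hc' : c' ≠ 0) (w' : ℂ),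
        Φ.symm.trans ((similarity c hc w).trans Φ) = similarity c' hc' w' ∨
        Φ.symm.trans ((similarity c hc w).trans Φ) =
          Complex.conjLIE.toHomeomorph.trans (similarity c' hc' w')) →
      ∃ (c : ℂ) (hc : c ≠ 0) (w : ℂ), Φ = similarity c hc w ∨
        Φ = Complex.conjLIE.toHomeomorph.trans (similarity c hc w))
    (h4c : ∀ φ : ℂ ≃ₜ ℂ,
      (∃ (c : ℂ) (hc : c ≠ 0) (w : ℂ), φ = similarity c hc w ∨
        φ = Complex.conjLIE.toHomeomorph.trans (similarity c hc w)) →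
      ∀ (D : DobrushinDomain) (μ : Measure (CurveClass ℂ)), IsSLELaw 6 D μ →
        IsSLELaw 6 (D.map φ) (μ.map (CurveClass.map (φ : C(ℂ, ℂ))))) :
    ∀ (P : ChordalFamily) (Φ : ℂ ≃ₜ ℂ), P.IsSimilarityCovariant →
      (∀ D : DobrushinDomain, IsSLELaw 6 D ((P (D.map Φ.symm)).map (CurveClass.map (Φ : C(ℂ, ℂ))))) →
      ∀ D : DobrushinDomain, IsSLELaw 6 D (P D) := by
  intro P Φ hsim hQ
  -- every conjugate `T_S := Φ ∘ S ∘ Φ⁻¹` of a similarity preserves the SLE₆ laws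
  have hT : ∀ (c : ℂ) (hc : c ≠ 0) (w : ℂ) (D : DobrushinDomain) (μ : Measure (CurveClass ℂ)),
      IsSLELaw 6 D μ →
        IsSLELaw 6 (D.map (Φ.symm.trans ((similarity c hc w).trans Φ)))
          (μ.map (CurveClass.map ((Φ.symm.trans ((similarity c hc w).trans Φ) : ℂ ≃ₜ ℂ) : C(ℂ, ℂ)))) := by
    intro c hc w D μ hμ
    have hμQ : μ = (P (D.map Φ.symm)).map (CurveClass.map (Φ : C(ℂ, ℂ))) := hμ.unique' (hQ D)
    have key : μ.map (CurveClass.map ((Φ.symm.trans ((similarity c hc w).trans Φ) : ℂ ≃ₜ ℂ) : C(ℂ, ℂ))) =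
        (P ((D.map (Φ.symm.trans ((similarity c hc w).trans Φ))).map Φ.symm)).map
          (CurveClass.map (Φ : C(ℂ, ℂ))) := by
      rw [hμQ, Measure.map_map (CurveClass.measurable_map _) (CurveClass.measurable_map _),
        ← CurveClass.map_homeomorph_trans, trans_symm_trans_cancel, CurveClass.map_homeomorph_trans,
        ← Measure.map_map (CurveClass.measurable_map _) (CurveClass.measurable_map _),
        ← hsim (D.map Φ.symm) c hc w, MarkedDomain.map_map, MarkedDomain.map_map,
        symm_trans_trans_trans_symm]
    rw [key]
    exact hQ _
  -- S4a: each `T_S` is an (anti)similarity; S4b: so is `Φ`; hence so is `Φ⁻¹`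
  have hΦ : ∃ (c : ℂ) (hc : c ≠ 0) (w : ℂ), Φ = similarity c hc w ∨
      Φ = Complex.conjLIE.toHomeomorph.trans (similarity c hc w) :=
    h4b Φ fun c hc w => h4a _ (hT c hc w)
  have hΦs := symm_isAntiSimilarity hΦ
  -- S4c: pull the identification back along `Φ⁻¹`
  intro D
  have h := h4c Φ.symm hΦs (D.map Φ) _ (hQ (D.map Φ))
  rwa [markedDomain_map_map_symm, measure_map_map_symm] at h

end GlueS4

/-- The former single stub S4 (`stub_isotropyRigidity`, verbatim statement), now a THEOREM of the three registered
stubs S4a–S4c. ISOTROPY KILLS BELTRAMI: if `P` is similarity covariant and some topological conjugate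
`Φ_* P Φ⁻¹` is the SLE₆ family, then `P` itself is the SLE₆ family. -/
theorem isotropyRigidity :
    ∀ (P : ChordalFamily) (Φ : ℂ ≃ₜ ℂ), P.IsSimilarityCovariant →
      (∀ D : DobrushinDomain, IsSLELaw 6 D ((P (D.map Φ.symm)).map (CurveClass.map (Φ : C(ℂ, ℂ))))) →
      ∀ D : DobrushinDomain, IsSLELaw 6 D (P D) :=
  isotropyRigidity_of_stubs stub_slePreservingIsMoebius stub_similarityConjugateRigidity
    stub_sleSixIsometryInvariance

/-- COMPOSITION (kernel-checked, no sorry, no stub used): the five stub STATEMENTS imply the crux statement.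
Hypotheses are the statements of `stub_regularityFromAxioms`, `stub_quasiUniformisation`, `stub_conjTransport`,
`stub_typedSchrammLSW`, `stub_isotropyRigidity` verbatim; the conclusion is the body of the crux decl verbatim
(`CardyRotToConfR2SymmetryUpgrade_of` below restates it BY NAME). `S0` feeds `S1`; `S2` + conformal covariance make the
conjugate family admissible; `S3` identifies it as SLE₆; `S4` pulls the identification back along `Φ` using similarity
covariance of `P`. -/
theorem composition :
    (∀ P : ChordalFamily, IsLocalMarkovChordalFamily P →
      (∀ D : DobrushinDomain, ∀ᵐ γ ∂(P D), ∀ c : Curve ℂ, CurveClass.mk c = γ →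
        ∀ s t : unitInterval, s < t → c '' Set.Icc s t ⊆ frontier D.carrier →
          (c '' Set.Icc s t).Subsingleton) →
      (∀ R : ConformalRectangle, 0 < P (R.chord 0 2 (by decide)) (CurveClass.hitsBefore (R.arc 2) (R.arc 1)) ∧
        P (R.chord 0 2 (by decide)) (CurveClass.hitsBefore (R.arc 2) (R.arc 1)) < 1) ∧
      (∀ D : DobrushinDomain, ∀ᵐ γ ∂(P D), ∀ ε : ℝ, 0 < ε → ∀ i : Fin 2,
        ∃ z ∈ γ.range ∩ D.arc i, z ≠ D.pt 0 ∧ dist z (D.pt 0) < ε)) →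
    (∀ P : ChordalFamily, IsLocalMarkovChordalFamily P →
      (∀ D : DobrushinDomain, ∀ᵐ γ ∂(P D), ∀ c : Curve ℂ, CurveClass.mk c = γ →
        ∀ s t : unitInterval, s < t → c '' Set.Icc s t ⊆ frontier D.carrier →
          (c '' Set.Icc s t).Subsingleton) →
      (∀ R : ConformalRectangle, 0 < P (R.chord 0 2 (by decide)) (CurveClass.hitsBefore (R.arc 2) (R.arc 1)) ∧
        P (R.chord 0 2 (by decide)) (CurveClass.hitsBefore (R.arc 2) (R.arc 1)) < 1) →
      (∀ D : DobrushinDomain, ∀ᵐ γ ∂(P D), ∀ ε : ℝ, 0 < ε → ∀ i : Fin 2,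
        ∃ z ∈ γ.range ∩ D.arc i, z ≠ D.pt 0 ∧ dist z (D.pt 0) < ε) →
      ∃ Φ : ℂ ≃ₜ ℂ, ChordalFamily.IsConformallyCovariant
        (fun D : DobrushinDomain => (P (D.map Φ.symm)).map (CurveClass.map (Φ : C(ℂ, ℂ))))) →
    (∀ (P : ChordalFamily) (Φ : ℂ ≃ₜ ℂ), P.IsChordal → P.IsDomainMarkov → P.IsLocal →
      P.IsTargetIndependent →
      (∀ D : DobrushinDomain, ∀ᵐ γ ∂(P D), ∀ c : Curve ℂ, CurveClass.mk c = γ →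
        ∀ s t : unitInterval, s < t → c '' Set.Icc s t ⊆ frontier D.carrier →
          (c '' Set.Icc s t).Subsingleton) →
      ChordalFamily.IsChordal (fun D : DobrushinDomain => (P (D.map Φ.symm)).map (CurveClass.map (Φ : C(ℂ, ℂ)))) ∧
      ChordalFamily.IsDomainMarkov (fun D : DobrushinDomain => (P (D.map Φ.symm)).map (CurveClass.map (Φ : C(ℂ, ℂ)))) ∧
      ChordalFamily.IsLocal (fun D : DobrushinDomain => (P (D.map Φ.symm)).map (CurveClass.map (Φ : C(ℂ, ℂ)))) ∧
      ChordalFamily.IsTargetIndependent (fun D : DobrushinDomain => (P (D.map Φ.symm)).map (CurveClass.map (Φ : C(ℂ, ℂ)))) ∧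
      (∀ D : DobrushinDomain, ∀ᵐ γ ∂((P (D.map Φ.symm)).map (CurveClass.map (Φ : C(ℂ, ℂ)))), ∀ c : Curve ℂ, CurveClass.mk c = γ →
        ∀ s t : unitInterval, s < t → c '' Set.Icc s t ⊆ frontier D.carrier →
          (c '' Set.Icc s t).Subsingleton)) →
    (∀ Q : ChordalFamily, IsLocalMarkovChordalFamily Q →
      (∀ D : DobrushinDomain, ∀ᵐ γ ∂(Q D), ∀ c : Curve ℂ, CurveClass.mk c = γ →
        ∀ s t : unitInterval, s < t → c '' Set.Icc s t ⊆ frontier D.carrier →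
          (c '' Set.Icc s t).Subsingleton) →
      Q.IsConformallyCovariant →
      ∀ D : DobrushinDomain, IsSLELaw 6 D (Q D)) →
    (∀ (P : ChordalFamily) (Φ : ℂ ≃ₜ ℂ), P.IsSimilarityCovariant →
      (∀ D : DobrushinDomain, IsSLELaw 6 D ((P (D.map Φ.symm)).map (CurveClass.map (Φ : C(ℂ, ℂ))))) →
      ∀ D : DobrushinDomain, IsSLELaw 6 D (P D)) →
    ∀ P : ChordalFamily, IsLocalMarkovChordalFamily P →
      (∀ D : DobrushinDomain, ∀ᵐ γ ∂(P D), ∀ c : Curve ℂ, CurveClass.mk c = γ →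
        ∀ s t : unitInterval, s < t → c '' Set.Icc s t ⊆ frontier D.carrier →
          (c '' Set.Icc s t).Subsingleton) →
      ∀ D : DobrushinDomain, IsSLELaw 6 D (P D) := by
  intro h0 h1 h2 h3 h4 P hP hNT D
  obtain ⟨Φ, hcc⟩ := h1 P hP hNT (h0 P hP hNT).1 (h0 P hP hNT).2
  obtain ⟨hch, hmk, hloc, hti, hnt'⟩ :=
    h2 P Φ hP.isChordal hP.markov hP.isLocal hP.targetIndependent hNT
  have hQ : IsLocalMarkovChordalFamily
      (fun D : DobrushinDomain => (P (D.map Φ.symm)).map (CurveClass.map (Φ : C(ℂ, ℂ)))) :=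
    ⟨hch, hcc.isSimilarityCovariant, hmk, hloc, hti⟩
  exact h4 P Φ hP.similarity (h3 _ hQ hnt' hcc) D

/-- THE SKELETON THEOREM: the crux BY NAME from the five registered stubs (sorries live only inside `stub_*`;
this declaration is itself sorry-free and becomes the crux proof when the stubs land). -/
theorem CardyRotToConfR2SymmetryUpgrade_of :
    Summit.CriticalPhenomena.CardyFormulaZ2.Theses.CardyRotToConf.CardyRotToConfR2SymmetryUpgrade :=
  composition stub_regularityFromAxioms stub_quasiUniformisation stub_conjTransport stub_typedSchrammLSW
    isotropyRigidity

/-- Twin conclusion for the second route wanting the crux (`CardySelfRefinement.SymmetryUpgrade` is the same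
statement verbatim; definitional unfolding). -/
theorem SymmetryUpgrade_of :
    Summit.CriticalPhenomena.CardyFormulaZ2.Theses.CardySelfRefinement.SymmetryUpgrade :=
  CardyRotToConfR2SymmetryUpgrade_of

end Summit.CriticalPhenomena.CardyFormulaZ2.Cruxes.CardyRotToConfR2SymmetryUpgrade.IsotropyKillsBeltrami
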